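import Mathlib
import Summits.Ventures.PercRepro2.ZMeanProof
import Summits.Ventures.PercRepro2.PendantRoot
import Summits.Ventures.PercRepro2.HMFLeaf

/-!
# (HMF) at a pendant `a₃` attached to a root: the mean-field form of (HCOV) in its first
attachment case (blind cell PercRepro2, night-1 g6; NIGHT1-G5.md §5 identity, the exploration lens)

Let `a₃` be a LEAF attached to the root `a₂` by the single edge `f` of weight `q = p f`, with
`o, b, a₁ ≠ a₃` and `o ≠ a₁`.  Exploring the cluster `A = C(a₃)`: on `{f closed}` it is `{a₃}`
(one PD-type row), on `{f open}` it is the heavy cluster `C(a₂)` (the T-type rows); `T′ = ∅`.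
With the residual shares `g_v(W) = P_{G∖W}(a₁ ↔ v)` (`delClusterProb`, antitone in `W`) the
mean-field value `X̂` of `ZMean.lean` is

  `X̂ = (1 − q) · [P(Q,oL) P(Q,bH) + P(Q,oH) P(Q,bL)] / P(Q) + q · E'[1_Q · g_o(C₂) · (1_{b ∈ C₂} − g_b(C₂))]`

(`E'` = expectation with `f` pinned open), and the cleared mean-field functional of
`ZMeanProof.lean` collapses to (`HMFc_pendant_root`)

  `HMFc = 2 q (1 − q) P(Q) · [ P(Q,oL) (P(Q,bH) − P(Q,bL)) − P(Q) P(Q,oL,bH) + P(Q) E'[1_Q g_o g_b] ]`,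

which is `≥ 0` because `P(Q) E'[1_Q g_o g_b] ≥ P(Q,oL) P(Q,bL)` (same-cluster BHK in functional
form, `bhk_same_cluster` applied to `1 − g_o`, `1 − g_b`: the Rao–Blackwellised same-side
covariance of the heavy cluster) and `P(Q) P(Q,oL,bH) ≤ P(Q,oL) P(Q,bH)` (cross-cluster BHK,
`bhk_cross_cluster`).  In the exploration vocabulary:
`HMF = q · P(Q) · [Cov_{C₂|Q}(g_o, g_b) − Cov_Q(1_{oL}, 1_{bH})]`.

Hence **`HMF_pendant_root`**: (HMF) — the mean-field strengthening of (HCOV), `HCov_of_HMF` —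
holds at every labelled instance whose `a₃` is a leaf at a root.
-/

namespace Summit.Ventures.PercRepro2

open UnionCluster CovForm PendantRoot

namespace HMFPendantRoot

variable {V : Type*} {E : Type*} [Fintype E] [DecidableEq E] [Fintype V] [DecidableEq V]
  {R : Type*} [Field R] [LinearOrder R] [IsStrictOrderedRing R]

/-! ## The heavy-cluster rows -/

section Heavy

variable (p : E → R) (ends : E → Sym2 V) {f : E} {a₃ a₂ : V}

/-- The residual share `g_v(W) = P_{G∖W}(a₁ ↔ v)` with the leaf edge pinned open. -/
noncomputable def g (f : E) (a₁ v : V) : Set V → R :=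
  delClusterProb (Function.update p f 1) ends a₁ {S : Set V | v ∈ S}

omit [LinearOrder R] [IsStrictOrderedRing R] in
/-- On a heavy cluster `W ∋ a₂`, `W ∌ a₁`, the T-row share of `termT` is `g_v(W)`. -/
lemma delConnProb_eq_g (hf : ends f = s(a₃, a₂)) {W : Finset V} {a₁ : V} (h1 : a₁ ∉ W)
    (h2 : a₂ ∈ W) (v : V) : delConnProb p ends W a₁ v = g p ends f a₁ v (↑W : Set V) := by
  classical
  have hset : {ω : Config E | cluster ends (delConfig ends (↑W : Set V) ω) a₁ ∈ {S : Set V | v ∈ S}} =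
      connDelEvent ends W a₁ v := by
    ext ω
    simp only [Set.mem_setOf_eq, mem_cluster, mem_connDelEvent, delConfig_eq_restrict]
  unfold g delClusterProb delConnProb
  rw [hset]
  by_cases hv : v ∈ W
  · rw [if_pos hv, connDelEvent_eq_empty ends h1 hv, prob_empty]
  · rw [if_neg hv]
    refine (prob_update_one_of_free p ?_).symm
    exact free_of_dependsOn_touches_compl ends (mem_touches_of_ends hf (Or.inr (Finset.mem_coe.2 h2)))
      (dependsOn_connDelEvent ends W a₁ v)

/-- The cluster functional of the heavy rows: `1_{a₁ ∉ S} · g_o(S) · (1_{b ∈ S} − g_b(S))`. -/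
noncomputable def Fheavy (f : E) (o a₁ b : V) : Set V → R := fun S =>
  ({T : Set V | a₁ ∉ T}).indicator 1 S *
    (g p ends f a₁ o S * (({T : Set V | b ∈ T}).indicator 1 S - g p ends f a₁ b S))

omit [LinearOrder R] [IsStrictOrderedRing R] in
/-- On a heavy cluster `termW` is the functional `Fheavy`. -/
lemma termW_eq_Fheavy (hf : ends f = s(a₃, a₂)) {W : Finset V} (o a₁ b : V) (h2 : a₂ ∈ W) :
    termW p ends o a₁ a₂ b W = Fheavy p ends f o a₁ b (↑W : Set V) := by
  unfold termW Fheavy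
  by_cases h1 : a₁ ∈ W
  · simp [h1, h2]
  · have h1' : (↑W : Set V) ∈ {T : Set V | a₁ ∉ T} := fun h => h1 (Finset.mem_coe.1 h)
    simp only [h1, h2, if_false, if_true, termT, delConnProb_eq_g p ends hf h1 h2,
      Set.indicator_of_mem h1', Pi.one_apply, one_mul]
    by_cases hb : b ∈ W
    · have hgb : g p ends f a₁ b (↑W : Set V) = 0 := by
        rw [← delConnProb_eq_g p ends hf h1 h2 b]
        simp [delConnProb, hb]
      rw [if_pos hb, Set.indicator_of_mem (show (↑W : Set V) ∈ {T : Set V | b ∈ T} from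
        Finset.mem_coe.2 hb), hgb]
      simp
    · rw [if_neg hb, Set.indicator_of_notMem (show (↑W : Set V) ∉ {T : Set V | b ∈ T} from
        fun h => hb (Finset.mem_coe.1 h))]
      ring

omit [LinearOrder R] [IsStrictOrderedRing R] in
/-- The heavy-cluster sum as an expectation with `f` pinned open. -/
lemma heavy_sum_eq (hf : ends f = s(a₃, a₂)) (o a₁ b : V) :
    ∑ W : Finset V, prob p (clusterEvent ends a₂ (↑W : Set V) ∩ openEdge f) *
        termW p ends o a₁ a₂ b W =
      p f * expect (Function.update p f 1) (fun ω => Fheavy p ends f o a₁ b (cluster ends ω a₂)) := by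
  rw [← expect_indicator_openEdge_mul, ← sum_prob_clusterEvent_inter_mul]
  refine Finset.sum_congr rfl fun W _ => ?_
  by_cases h2 : a₂ ∈ W
  · rw [termW_eq_Fheavy p ends hf o a₁ b h2]
  · have hempty : clusterEvent ends a₂ (↑W : Set V) ∩ openEdge f = ∅ := by
      ext ω
      simp only [Set.mem_inter_iff, mem_clusterEvent, Set.mem_empty_iff_false, iff_false, not_and]
      intro h _
      exact h2 (Finset.mem_coe.1 (h ▸ mem_cluster_self ends ω a₂))
    rw [hempty, prob_empty, zero_mul, zero_mul]

/-- `E'[1_Q · g_o(C₂) · g_b(C₂)]`: the Rao–Blackwellised same-side product of the heavy rows. -/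
noncomputable def Eprod (f : E) (o a₁ a₂ b : V) : R :=
  expect (Function.update p f 1) (fun ω => g p ends f a₁ o (cluster ends ω a₂) *
    g p ends f a₁ b (cluster ends ω a₂) * ((connEvent ends a₂ a₁)ᶜ).indicator 1 ω)

omit [DecidableEq V] [LinearOrder R] [IsStrictOrderedRing R] in
/-- `E'[Fheavy(C₂)] = P'(bH, oL, Q) − E'[1_Q g_o g_b]`. -/
lemma expect_Fheavy (o a₁ b : V) :
    expect (Function.update p f 1) (fun ω => Fheavy p ends f o a₁ b (cluster ends ω a₂)) =
      prob (Function.update p f 1) (connEvent ends a₂ b ∩ connEvent ends a₁ o ∩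
          (connEvent ends a₂ a₁)ᶜ) -
        Eprod p ends f o a₁ a₂ b := by
  have h1 := prob_clusterIn_inter_eq_expect (Function.update p f 1) ends a₂ a₁
    {S : Set V | b ∈ S} {S : Set V | o ∈ S}
  rw [clusterInEvent_mem_eq, clusterInEvent_mem_eq] at h1
  rw [h1]
  unfold Eprod
  rw [← expect_sub]
  refine congrArg _ (funext fun ω => ?_)
  simp only [Fheavy, Pi.sub_apply, g]
  have hQ : ((connEvent ends a₂ a₁)ᶜ).indicator (1 : Config E → R) ω =
      ({T : Set V | a₁ ∉ T}).indicator 1 (cluster ends ω a₂) := by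
    by_cases h : a₁ ∈ cluster ends ω a₂
    · rw [Set.indicator_of_notMem (show ω ∉ (connEvent ends a₂ a₁)ᶜ from fun h' => h' h),
        Set.indicator_of_notMem (show cluster ends ω a₂ ∉ {T : Set V | a₁ ∉ T} from fun h' => h' h)]
    · rw [Set.indicator_of_mem (show ω ∈ (connEvent ends a₂ a₁)ᶜ from h),
        Set.indicator_of_mem (show cluster ends ω a₂ ∈ {T : Set V | a₁ ∉ T} from h)]
      rfl
  rw [hQ]
  ring

/-- **Same-cluster BHK in functional form** for the heavy rows:
`P'(Q, oL) · P'(Q, bL) ≤ E'[1_Q g_o g_b] · P'(Q)`. -/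
lemma bhk_same_heavy (hp : IsProbVec p) (o a₁ b : V) :
    prob (Function.update p f 1) (connEvent ends a₁ o ∩ (connEvent ends a₂ a₁)ᶜ) *
        prob (Function.update p f 1) (connEvent ends a₁ b ∩ (connEvent ends a₂ a₁)ᶜ) ≤
      Eprod p ends f o a₁ a₂ b * prob (Function.update p f 1) (connEvent ends a₂ a₁)ᶜ := by
  classical
  set p' := Function.update p f 1 with hp'def
  have hp' : IsProbVec p' := hp.update f zero_le_one le_rfl
  have hup : ∀ v : V, IsUpperSet {S : Set V | v ∈ S} := fun v _ _ hST h => hST h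
  have hanti : ∀ v : V, Antitone (g p ends f a₁ v) := fun v =>
    delClusterProb_anti p' hp' ends a₁ (hup v)
  have hle1 : ∀ v S, g p ends f a₁ v S ≤ 1 := fun v S => delClusterProb_le_one p' hp' ends a₁ _ S
  have hmono : ∀ v : V, Monotone (fun S => 1 - g p ends f a₁ v S) := fun v S T hST => by
    have := hanti v hST; linarith
  have hnn : ∀ v : V, ∀ S, 0 ≤ 1 - g p ends f a₁ v S := fun v S => by
    have := hle1 v S; linarith
  have key := bhk_same_cluster p' hp' ends a₂ a₁ (hmono o) (hmono b) (hnn o) (hnn b)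
  -- the four expectations
  have eo := prob_clusterIn_inter_eq_expect p' ends a₂ a₁ Set.univ {S : Set V | o ∈ S}
  have eb := prob_clusterIn_inter_eq_expect p' ends a₂ a₁ Set.univ {S : Set V | b ∈ S}
  simp only [Set.indicator_univ, Pi.one_apply, one_mul, clusterInEvent_mem_eq] at eo eb
  have eu : clusterInEvent ends a₂ Set.univ = Set.univ := by ext; simp [clusterInEvent]
  rw [eu, Set.univ_inter] at eo eb
  have hQ : prob p' (connEvent ends a₂ a₁)ᶜ =
      expect p' (fun ω => ((connEvent ends a₂ a₁)ᶜ).indicator 1 ω) := prob_eq_expect_indicator _ _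
  have l1 : expect p' (fun ω => (1 - g p ends f a₁ o (cluster ends ω a₂)) *
      ((connEvent ends a₂ a₁)ᶜ).indicator 1 ω) =
      prob p' (connEvent ends a₂ a₁)ᶜ - prob p' (connEvent ends a₁ o ∩ (connEvent ends a₂ a₁)ᶜ) := by
    rw [eo, hQ, ← expect_sub]
    refine congrArg _ (funext fun ω => ?_)
    simp only [Pi.sub_apply, g]; ring
  have l2 : expect p' (fun ω => (1 - g p ends f a₁ b (cluster ends ω a₂)) *
      ((connEvent ends a₂ a₁)ᶜ).indicator 1 ω) =
      prob p' (connEvent ends a₂ a₁)ᶜ - prob p' (connEvent ends a₁ b ∩ (connEvent ends a₂ a₁)ᶜ) := by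
    rw [eb, hQ, ← expect_sub]
    refine congrArg _ (funext fun ω => ?_)
    simp only [Pi.sub_apply, g]; ring
  have l3 : expect p' (fun ω => (1 - g p ends f a₁ o (cluster ends ω a₂)) *
      (1 - g p ends f a₁ b (cluster ends ω a₂)) * ((connEvent ends a₂ a₁)ᶜ).indicator 1 ω) =
      prob p' (connEvent ends a₂ a₁)ᶜ - prob p' (connEvent ends a₁ o ∩ (connEvent ends a₂ a₁)ᶜ) -
        prob p' (connEvent ends a₁ b ∩ (connEvent ends a₂ a₁)ᶜ) + Eprod p ends f o a₁ a₂ b := by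
    rw [eo, eb, hQ]
    unfold Eprod
    rw [← expect_sub, ← expect_sub, ← expect_add]
    refine congrArg _ (funext fun ω => ?_)
    simp only [Pi.sub_apply, Pi.add_apply, g]; ring
  rw [l1, l2, l3] at key
  nlinarith [key]

/-- **Cross-cluster BHK** for the leaf-free world: `P'(oL, bH, Q) · P'(Q) ≤ P'(oL, Q) · P'(bH, Q)`. -/
lemma bhk_cross_heavy (hp : IsProbVec p) (o a₁ b : V) :
    prob (Function.update p f 1) (connEvent ends a₂ b ∩ connEvent ends a₁ o ∩
          (connEvent ends a₂ a₁)ᶜ) *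
        prob (Function.update p f 1) (connEvent ends a₂ a₁)ᶜ ≤
      prob (Function.update p f 1) (connEvent ends a₁ o ∩ (connEvent ends a₂ a₁)ᶜ) *
        prob (Function.update p f 1) (connEvent ends a₂ b ∩ (connEvent ends a₂ a₁)ᶜ) := by
  have hp' : IsProbVec (Function.update p f 1) := hp.update f zero_le_one le_rfl
  have key := bhk_cross_cluster (Function.update p f 1) hp' ends a₁ a₂
    (𝓤 := {S : Set V | o ∈ S}) (𝓥 := {S : Set V | b ∈ S}) (fun _ _ hST h => hST h)
    (fun _ _ hST h => hST h)
  rw [clusterInEvent_mem_eq, clusterInEvent_mem_eq, connEvent_comm ends a₁ a₂] at key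
  have e : connEvent ends a₁ o ∩ connEvent ends a₂ b ∩ (connEvent ends a₂ a₁)ᶜ =
      connEvent ends a₂ b ∩ connEvent ends a₁ o ∩ (connEvent ends a₂ a₁)ᶜ := by
    rw [Set.inter_comm (connEvent ends a₁ o)]
  rw [e] at key
  exact key

end Heavy

/-! ## The identity and the theorem -/

section Main

variable (p : E → R) (ends : E → Sym2 V)

omit [Fintype V] [DecidableEq V] [LinearOrder R] [IsStrictOrderedRing R] in
/-- The heavy-world masses with `f` pinned open are the `Q`-masses of the leaf-free world. -/
lemma prob_update_one_inter_compl {f : E} {a₃ a₂ : V} (hf : ends f = s(a₃, a₂))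
    (hleaf : ∀ e, a₃ ∈ ends e → e = f) (h32 : a₃ ≠ a₂) {a₁ : V} (h31 : a₃ ≠ a₁)
    {X : Set (Config E)} (hX : Free f X) :
    prob (Function.update p f 1) (X ∩ (connEvent ends a₂ a₁)ᶜ) =
      prob p (avoidAll ends a₂ {a₁} ∩ X) := by
  have c₂₁ : Free f (connEvent ends a₂ a₁)ᶜ :=
    (free_connEvent hf hleaf h32 (Ne.symm h32) (Ne.symm h31)).compl
  rw [prob_update_one_of_free p (hX.inter c₂₁), avoidAll_eq_compl, connEvent_comm ends a₁ a₂,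
    Set.inter_comm]

/-- **The mean-field identity at a pendant root** (NIGHT1-G5.md §5): with `q = p f`,
`HMFc = 2 q (1 − q) P(Q) · [P(Q,oL) (P(Q,bH) − P(Q,bL)) − P(Q) P(Q,oL,bH) + P(Q) E'[1_Q g_o g_b]]`. -/
theorem HMFc_pendant_root (hp : IsProbVec p) {f : E} {a₃ a₂ : V} (hf : ends f = s(a₃, a₂))
    (hleaf : ∀ e, a₃ ∈ ends e → e = f) (h32 : a₃ ≠ a₂) {o a₁ b : V} (h31 : a₃ ≠ a₁)
    (ho : o ≠ a₃) (hb : b ≠ a₃) :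
    HMFc p ends o a₁ a₂ a₃ b =
      2 * p f * (1 - p f) * prob p (avoidAll ends a₂ {a₁}) *
        (prob p (avoidAll ends a₂ {a₁} ∩ connEvent ends a₁ o) *
            (prob p (avoidAll ends a₂ {a₁} ∩ connEvent ends a₂ b) -
              prob p (avoidAll ends a₂ {a₁} ∩ connEvent ends a₁ b)) -
          prob p (avoidAll ends a₂ {a₁}) *
            prob p (avoidAll ends a₂ {a₁} ∩ (connEvent ends a₂ b ∩ connEvent ends a₁ o)) +
          prob p (avoidAll ends a₂ {a₁}) * Eprod p ends f o a₁ a₂ b) := by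
  have h21 : a₂ ≠ a₃ := Ne.symm h32
  have h13 : a₁ ≠ a₃ := Ne.symm h31
  have c₁o := free_connEvent hf hleaf h32 h13 ho
  have c₂o := free_connEvent hf hleaf h32 h21 ho
  have c₁b := free_connEvent hf hleaf h32 h13 hb
  have c₂b := free_connEvent hf hleaf h32 h21 hb
  have hP' := prob_update_one_inter_compl p ends hf hleaf h32 h31 (c₂b.inter c₁o)
  have ht := termW_leaf p hp hf hleaf h32 h31 ho hb
  unfold HMFc marginC DEF EQo EQ3 EQ3o Do massM2 deltaT
  rw [gap_eq_Q, Xhat_pendant p ends hf hleaf h32 o a₁ b, heavy_sum_eq p ends hf o a₁ b,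
    expect_Fheavy p ends o a₁ b, hP',
    Set.inter_comm (connEvent ends a₂ b) (TEvent ends a₁ a₂ a₃),
    Set.inter_comm (connEvent ends a₁ b) (TEvent ends a₁ a₂ a₃)]
  simp only [prob_PD p hf hleaf h32 h31, prob_T p hf hleaf h32 h31, prob_T' p hf hleaf h32 h31,
    prob_T'_inter p hf hleaf h32 h31,
    prob_PD_inter p hf hleaf h32 h31 c₁o, prob_PD_inter p hf hleaf h32 h31 c₂o,
    prob_PD_inter p hf hleaf h32 h31 c₂b,
    prob_T_inter p hf hleaf h32 h31 c₁o, prob_T_inter p hf hleaf h32 h31 c₂o,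
    prob_T_inter p hf hleaf h32 h31 c₁b, prob_T_inter p hf hleaf h32 h31 c₂b]
  linear_combination (-2 * (1 - p f) ^ 2 * prob p (avoidAll ends a₂ {a₁})) * ht

/-- **(HMF) at a pendant `a₃` attached to the root `a₂`**: the mean-field form of (HCOV)
(`HMF`, row 2′HMF) holds for every admissible weight vector — same-cluster BHK in functional form
(the Rao–Blackwellised same-side covariance of the heavy cluster) beats the cross-cluster BHK
covariance, exactly as the exploration of `C(a₃)` predicts. -/
theorem HMF_pendant_root (hp : IsProbVec p) {f : E} {a₃ a₂ : V} (hf : ends f = s(a₃, a₂))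
    (hleaf : ∀ e, a₃ ∈ ends e → e = f) (h32 : a₃ ≠ a₂) {o a₁ b : V} (h31 : a₃ ≠ a₁)
    (ho : o ≠ a₃) (hb : b ≠ a₃) : HMF p ends o a₁ a₂ a₃ b := by
  unfold HMF
  rw [HMFc_pendant_root p ends hp hf hleaf h32 h31 ho hb]
  have h21 : a₂ ≠ a₃ := Ne.symm h32
  have h13 : a₁ ≠ a₃ := Ne.symm h31
  have c₁o := free_connEvent hf hleaf h32 h13 ho
  have c₁b := free_connEvent hf hleaf h32 h13 hb
  have c₂b := free_connEvent hf hleaf h32 h21 hb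
  have cQ : Free f (connEvent ends a₂ a₁)ᶜ :=
    (free_connEvent hf hleaf h32 (Ne.symm h32) (Ne.symm h31)).compl
  -- the two BHK bounds, transported to the leaf-free world
  have hsame := bhk_same_heavy p ends (f := f) (a₂ := a₂) hp o a₁ b
  have hcross := bhk_cross_heavy p ends (f := f) (a₂ := a₂) hp o a₁ b
  rw [prob_update_one_inter_compl p ends hf hleaf h32 h31 c₁o,
    prob_update_one_inter_compl p ends hf hleaf h32 h31 c₁b,
    prob_update_one_of_free p cQ, avoidAll_eq_compl (ends := ends) a₁ a₂,
    connEvent_comm ends a₁ a₂] at hsame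
  rw [prob_update_one_inter_compl p ends hf hleaf h32 h31 (c₂b.inter c₁o),
    prob_update_one_inter_compl p ends hf hleaf h32 h31 c₁o,
    prob_update_one_inter_compl p ends hf hleaf h32 h31 c₂b,
    prob_update_one_of_free p cQ, avoidAll_eq_compl (ends := ends) a₁ a₂,
    connEvent_comm ends a₁ a₂] at hcross
  rw [avoidAll_eq_compl, connEvent_comm ends a₁ a₂]
  have hq0 := hp.nonneg f
  have hq1 := sub_nonneg.2 (hp.le_one f)
  have hZ := prob_nonneg hp (connEvent ends a₂ a₁)ᶜ
  refine mul_nonneg (mul_nonneg (mul_nonneg (mul_nonneg (by norm_num) hq0) hq1) hZ) ?_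
  nlinarith [hsame, hcross]

end Main

end HMFPendantRoot

end Summit.Ventures.PercRepro2
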